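import Literature.AlgebraicGeometry.Frobenioids.ArchimedeanUnitStabilizersThm36v
import Literature.AlgebraicGeometry.Frobenioids.ArchimedeanAutActionWitness
import Literature.AlgebraicGeometry.Frobenioids.ArchimedeanAmpleness
import Literature.AlgebraicGeometry.Frobenioids.TopologicalRepresentationProofs
import Mathlib.Topology.Homeomorph.Lemmas
import Mathlib.LinearAlgebra.TensorProduct.Basic
import HarnessLib

/-!
# Frobenioids II, Theorem 3.6 (iv) [first sentence], (v), (vii): the schemata `Thm36iv_factors`,
# `Thm36v_trivial`, `Thm36v_torsionFree`, `Thm36v_isoCircleTensorRat`, `Thm36v_orderTwo`,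
# `Thm36v_torsion`, `Thm36v_isoCircle`, `Thm36vii_equiv`, `Thm36vii_recover`, `Thm36vii_torsor`
# (FACT-LIST F-0785, F-0794, F-0793, F-0790, F-0791, F-0792, F-0789, F-1298, F-1299, F-0795) have
# REFUTABLE universal closures — they are facts AT THE NAMED INSTANCES only (part C)

Mochizuki, *The geometry of Frobenioids II: poly-Frobenioids*, Kyushu J. Math. **62** (2008) 401–460,
§3, Theorem 3.6 (iv) p. 37 ("the natural action of `Aut_F(A)` on `O^▷(A), O^×(A)` factors through
`Aut_{D₀}(A₀)`"), (v) p. 37 (the structure of `O^×(A)`: trivial / nontrivial torsion-free `≅ S¹ ⊗_ℤ ℚ` /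
of order two / infinitely many torsion elements `≅ S¹`, according to `Λ` and to `A` real, complex,
isotropic) and (vii) pp. 37–38 (`F^imtr-pre_A ⥲ Open⁰(∂A_A)`; `∂A_A` recovered functorially; `∂A_A` an
`O^×(A)`-torsor) [cite: MochizukiFrdII2008, Thm 3.6 pp.36-38].

Negative knowledge recorded next to `ArchimedeanBasicProperties.lean` (abc-iut-L1-t9), PROOF-ONLY (no
definition, no instance), abc-iut cell seat abc-iut-f-008 (block F, float on the bindable «model-witness»
rows of the trunk file; class `preparatory`, kernel_closedness `parametrised`).  Parts A / B:
`ArchimedeanBasicPropertiesSchemaNegative.lean` (F-0691/0693/0694, seat f-007),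
`ArchimedeanBasicPropertiesSchemaNegativeB.lean` (F-0779/0780/0781/0783).

Each row is a PARAMETRISED predicate binding, besides the structure functor `F : X → F_Φ`, the LABEL
`Λ ∈ {ℤ, ℚ, ℝ}`, the comparison functor `G : D → ArchBase` deciding which objects are "real"/"complex",
and for (vii) the topological data `(V, bd, vMap)` — all FREE.  The statement file says so itself
("Schema label … NO OTHER binding is a statement of the paper").  The universal closures are therefore
false, and — this is the point of this part — they already fail IN THE PAPER'S OWN CATEGORIES
`C₀` / `C := C₀ ×_{D₀} D₀` of Example 3.3 (over the identity base `𝟭 D₀`) as soon as ONE free parameter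
is moved off its printed value, by the tree's own PROVED instance theorems:

* (v) with the label moved (`Λ := ℚ` or `ℝ` on `C = C^ℤ`): the real tip-`1` object has `|O^×| = 2`
  (`UnitStab.card_unitsSubgroup_of_isReal`), the complex isotropic tip-`1` object has infinitely many
  torsion units and `O^× ≠ 1` (`UnitStab.torsion_infinite_of_isComplex`, `UnitStab.thm36v_*_C`), and its
  unit `−1` of order two (`UnitStab.negUnit`) cannot live in the torsion-free group `S¹ ⊗_ℤ ℚ`;
* (v) "`≅ S¹`" and (iv) with the comparison functor moved to a CONSTANT functor `D₀ → ArchBase` (so that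
  a real object counts as "complex", resp. so that the lift of complex conjugation has the same image as
  the identity): `|O^×(real)| = 2 ≠ |S¹|`; conjugation by the conj-lift `C0.liftAut` inverts the unit
  `i ∈ O^×(A) ≅ S¹` (`C0.scalar_conj`);
* (vii) with the topological data moved (`∂A_A := ∅`, `V_A := Bool` with identity maps, `V_A :=` the
  Cantor space `ℕ → Bool`): `Open⁰(∅)` is empty while `F^imtr-pre_A ∋ id_A`; a constant orbit map is not
  transitive on two points; the Cantor space is not locally connected (Rmk. A.2.1,
  `TopRep.RmkA21_profinite_holds`).

Theorems: `not_forall_thm36iv_factors`, `not_forall_thm36v_trivial`, `not_forall_thm36v_torsionFree`,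
`not_forall_thm36v_isoCircleTensorRat`, `not_forall_thm36v_orderTwo`, `not_forall_thm36v_torsion`,
`not_forall_thm36v_isoCircle`, `not_forall_thm36vii_equiv`, `not_forall_thm36vii_recover`,
`not_forall_thm36vii_torsor` (¬ of the fully quantified closures, universe level `0`), each from a named
¬-instance `not_<decl>_C…` / `_C0…`.

The INSTANCE forms — the only statements of the paper — are PROVED in the tree and are what consumers
bind: (iv) `ArchFrd.thm36iv_factors_C` (F-0785 model witness, `ArchimedeanAutActionFactors.lean`),
`ArchFrd.thm36iv_A_holds` (F-0876 ✓), `ArchFrd.Thm36Sub.thm36iv_C_holds` (F-0877 at THE data); (v)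
`ArchFrd.UnitStab.thm36v_trivial_C` / `thm36v_orderTwo_C` / `thm36v_torsion_C` / `thm36v_torsionFree_C` /
`thm36v_isoCircleTensorRat_C` (`ArchimedeanUnitStabilizersThm36v.lean`), `ArchFrd.thm36v_isoCircle_C`
(`ArchimedeanUnitCircle.lean`), `ArchFrd.thm36v_A_holds` (F-0880 ✓), `ArchFrd.Thm36Sub.thm36v_C_holds`
(F-0881 at THE data, incl. the `Λ = ℚ` perfection `Thm36Sub.v_Q_holds` and `Λ = ℝ` `v_R_holds`); (vii)
`ArchFrd.thm36vii_C` / `thm36vii_A` (F-0884 ✓ / F-0883 ✓: `thm36vii_equiv_C`, `thm36vii_recover_C`,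
`thm36vii_torsor_C` and the angular twins).  So each row is admissible ONLY in its instance form
(FACT-LIST class «universal-closure REFUTED; instance form PROVED»).  Nothing here bears on the disputed
[IUTchIII] Cor. 3.12 or takes a side; refuted-as-schema is a statement about OUR typing, not about the paper.
-/

namespace Literature.AlgebraicGeometry.Frobenioids

namespace ArchFrd

open CategoryTheory
open scoped TensorProduct

/-! ### The two test objects of `C := C₀ ×_{D₀} D₀` over `𝟭 D₀`: the tip-`1` isotropic objects over
`Spec ℂ` and `Spec ℝ` (`unitObjOver`, `ArchimedeanPseudoTerminal.lean`) -/

namespace SchemaNegC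

/-- The tip-`1` object over `Spec ℂ` is a complex object for the comparison functor `D₀ → ArchBase`.
[cite: MochizukiFrdII2008, Def 3.1 (v) p.24] -/
theorem unitObjOver_complex :
    RC.complexObjects (PreFrobenioid.baseFunctor (C.toElem (𝟭 D0)) ⋙ (𝟭 D0 ⋙ D0.toArchBase))
      (unitObjOver (𝟭 D0) D0.complex) :=
  (D0.isComplex_toArchBase_iff D0.complex).mpr rfl

/-- The tip-`1` object over `Spec ℂ` is naively isotropic. [cite: MochizukiFrdII2008, Ex 3.3 (i) p.27] -/
theorem unitObjOver_naive : (unitObjOver (𝟭 D0) D0.complex).fst.IsNaivelyIsotropic :=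
  AngularRegion.isIsotropic_isotropicOfTip 1

/-- The tip-`1` object over `Spec ℂ` has complex `C₀`-component. [cite: MochizukiFrdII2008, Def 3.1 (v) p.24] -/
theorem unitObjOver_isComplexObj : (unitObjOver (𝟭 D0) D0.complex).fst.IsComplexObj := rfl

/-- The tip-`1` object over `Spec ℂ` is isotropic ([FrdI] Def. 1.2 (iv), via Ex. 3.3 (ii)).
[cite: MochizukiFrdII2008, Ex 3.3 (ii) p.28] -/
theorem unitObjOver_isIsotropic :
    PreFrobenioid.IsIsotropic (C.toElem (𝟭 D0)) (unitObjOver (𝟭 D0) D0.complex) :=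
  (Ex33ii_isotropic_iff_holds (𝟭 D0) (unitObjOver (𝟭 D0) D0.complex)).mpr unitObjOver_naive

/-- The tip-`1` object over `Spec ℝ` lies over `Spec ℝ`. [cite: MochizukiFrdII2008, Def 3.1 (v) p.24] -/
theorem unitObjOver_real_isReal : ((𝟭 D0).obj (unitObjOver (𝟭 D0) D0.real).snd).IsReal := rfl

/-- `S¹ ⊗_ℤ ℚ` has no `2`-torsion: halving the `ℚ`-factor inverts doubling.
[cite: MochizukiFrdII2008, Thm 3.6 (v) p.37] -/
theorem eq_zero_of_add_self_eq_zero (x : Additive Circle ⊗[ℤ] ℚ) (h : x + x = 0) : x = 0 := by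
  let half : ℚ →ₗ[ℤ] ℚ := (AddMonoidHom.mulLeft (2⁻¹ : ℚ)).toIntLinearMap
  let H : Additive Circle ⊗[ℤ] ℚ →ₗ[ℤ] Additive Circle ⊗[ℤ] ℚ := TensorProduct.map LinearMap.id half
  have key : ∀ y : Additive Circle ⊗[ℤ] ℚ, H (y + y) = y := by
    intro y
    induction y using TensorProduct.induction_on with
    | zero => rw [add_zero, map_zero]
    | tmul a q =>
      rw [← TensorProduct.tmul_add, TensorProduct.map_tmul]
      change a ⊗ₜ[ℤ] ((2 : ℚ)⁻¹ * (q + q)) = a ⊗ₜ[ℤ] q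
      rw [show (2 : ℚ)⁻¹ * (q + q) = q by ring]
    | add y z hy hz => rw [add_add_add_comm, map_add, hy, hz]
  rw [← key x, h, map_zero]

end SchemaNegC

open SchemaNegC

/-! ### F-0785: `Thm36iv_factors` -/

/-- **F-0785, universal closure false:** with the comparison functor `G` moved to the CONSTANT functor
`D₀ → ArchBase` (value `Spec ℝ`), every automorphism has the same image "in `Aut_{D₀}(A₀)`", so
`Thm36iv_factors G (C₀ → F_{Φ₀})` would force the lift `C0.liftAut A conj` of complex conjugation to the
complex tip-`1` object `A` and the identity to act identically on `O^×(A) ≅ S¹` — but conjugation by the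
conj-lift sends the unit `i` to `conj(i) = −i` (`C0.scalar_conj`). [cite: MochizukiFrdII2008, Thm 3.6 (iv) p.37] -/
theorem not_thm36iv_factors_C0_constBase :
    ¬ Thm36iv_factors ((Functor.const D0).obj (D0.toArchBase.obj D0.real)) C0.toElem := by
  intro h
  have hA : (C0.unitObj D0.complex).IsNaivelyIsotropic := AngularRegion.isIsotropic_isotropicOfTip 1
  have hc : (C0.unitObj D0.complex).IsComplexObj := rfl
  have hI : ‖((Units.mk0 Complex.I Complex.I_ne_zero : ℂˣ) : ℂ)‖ = 1 := by simp
  obtain ⟨-, hu⟩ := h (C0.unitObj D0.complex) (C0.liftAut (C0.unitObj D0.complex) D0.conj)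
    (Iso.refl _) (Iso.ext rfl)
  have key := hu (C0.unitScalarAut _ hA hc _ hI) (C0.unitScalarAut_mem _ hA hc _ hI)
  have hsc := congrArg
    (fun i : C0.unitObj D0.complex ≅ C0.unitObj D0.complex => C0.scalar i.hom) key
  simp only [Iso.trans_hom, Iso.symm_hom] at hsc
  rw [C0.scalar_conj (C0.liftAut (C0.unitObj D0.complex) D0.conj) _ rfl rfl,
    C0.scalar_conj (Iso.refl (C0.unitObj D0.complex)) _ rfl rfl] at hsc
  change D0.galAct true (Units.mk0 Complex.I Complex.I_ne_zero) =
    D0.galAct false (Units.mk0 Complex.I Complex.I_ne_zero) at hsc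
  have hI' := congrArg (fun x : ℂˣ => (x : ℂ)) hsc
  simp only [D0.galAct_true, D0.galAct_false, Units.coe_star, Units.val_mk0, Complex.star_def,
    Complex.conj_I] at hI'
  exact Complex.I_ne_zero (by linear_combination (-1 : ℂ) / 2 * hI')

/-- **F-0785 as a schema is not a fact:** the fully quantified closure of `ArchFrd.Thm36iv_factors` (over
all comparison functors `G` and structure functors `F`, at universe level `0`) is FALSE.  The printed
first sentence of Thm. 3.6 (iv) is the instance family `ArchFrd.thm36iv_factors_C` / `thm36iv_A_holds` /
`Thm36Sub.thm36iv_C_holds` at `G :=` the comparison functor of Example 3.3.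
[cite: MochizukiFrdII2008, Thm 3.6 (iv) p.37] -/
theorem not_forall_thm36iv_factors :
    ¬ ∀ {D : Type} [Category.{0} D] (G : D ⥤ ArchBase) {Φ : Dᵒᵖ ⥤ CommMonCat.{0}} {X : Type}
        [Category.{0} X] (F : X ⥤ ElemFrobenioid Φ), Thm36iv_factors G F :=
  fun h => not_thm36iv_factors_C0_constBase (h _ C0.toElem)

/-! ### F-0794: `Thm36v_trivial` -/

/-- **F-0794, universal closure false:** with the label moved to `Λ := ℝ`, clause (c) of Thm. 3.6 (v)
would make EVERY `O^×(A)` of `C = C^ℤ` trivial; the complex isotropic tip-`1` object has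
`O^×(A) ≅ S¹ ≠ 1` (`UnitStab.thm36v_trivial_C`). [cite: MochizukiFrdII2008, Thm 3.6 (v) p.37] -/
theorem not_thm36v_trivial_C_R :
    ¬ Thm36v_trivial (𝟭 D0 ⋙ D0.toArchBase) (C.toElem (𝟭 D0)) MonoidType.R := by
  intro h
  have hbot := (h (unitObjOver (𝟭 D0) D0.complex)).mpr (Or.inr (Or.inr rfl))
  rcases (UnitStab.thm36v_trivial_C (𝟭 D0) (unitObjOver (𝟭 D0) D0.complex)).mp hbot with
    ⟨-, -, hni⟩ | ⟨hQ, -⟩ | hR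
  · exact hni unitObjOver_isIsotropic
  · exact MonoidType.noConfusion hQ
  · exact MonoidType.noConfusion hR

/-- **F-0794 as a schema is not a fact:** the fully quantified closure of `ArchFrd.Thm36v_trivial` (at
universe level `0`) is FALSE; the printed clause is `UnitStab.thm36v_trivial_C` (`Λ = ℤ`), `Thm36Sub.v_Q_holds`
/ `v_R_holds` (`Λ ∈ {ℚ, ℝ}` at THE perfection / realification), `thm36v_A_holds`.
[cite: MochizukiFrdII2008, Thm 3.6 (v) p.37] -/
theorem not_forall_thm36v_trivial :
    ¬ ∀ {D : Type} [Category.{0} D] (G : D ⥤ ArchBase) {Φ : Dᵒᵖ ⥤ CommMonCat.{0}} {X : Type}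
        [Category.{0} X] (F : X ⥤ ElemFrobenioid Φ) (Λ : MonoidType), Thm36v_trivial G F Λ :=
  fun h => not_thm36v_trivial_C_R (h _ _ _)

/-! ### F-0793: `Thm36v_torsionFree` -/

/-- **F-0793, universal closure false:** with the label moved to `Λ := ℚ` on `C = C^ℤ`, the right-hand
side "`Λ = ℚ` and `A` complex" holds at the complex isotropic tip-`1` object, whose `O^×(A) ≅ S¹` is NOT
torsion-free (`UnitStab.thm36v_torsionFree_C`). [cite: MochizukiFrdII2008, Thm 3.6 (v) p.37] -/
theorem not_thm36v_torsionFree_C_Q :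
    ¬ Thm36v_torsionFree (𝟭 D0 ⋙ D0.toArchBase) (C.toElem (𝟭 D0)) MonoidType.Q := fun h =>
  MonoidType.noConfusion
    ((UnitStab.thm36v_torsionFree_C (𝟭 D0) (unitObjOver (𝟭 D0) D0.complex)).mp
      ((h (unitObjOver (𝟭 D0) D0.complex)).mpr ⟨rfl, unitObjOver_complex⟩)).1

/-- **F-0793 as a schema is not a fact:** the fully quantified closure of `ArchFrd.Thm36v_torsionFree`
(at universe level `0`) is FALSE; instance forms as for F-0794. [cite: MochizukiFrdII2008, Thm 3.6 (v) p.37] -/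
theorem not_forall_thm36v_torsionFree :
    ¬ ∀ {D : Type} [Category.{0} D] (G : D ⥤ ArchBase) {Φ : Dᵒᵖ ⥤ CommMonCat.{0}} {X : Type}
        [Category.{0} X] (F : X ⥤ ElemFrobenioid Φ) (Λ : MonoidType), Thm36v_torsionFree G F Λ :=
  fun h => not_thm36v_torsionFree_C_Q (h _ _ _)

/-! ### F-0790: `Thm36v_isoCircleTensorRat` -/

/-- **F-0790, universal closure false:** with the label moved to `Λ := ℚ` on `C = C^ℤ`, the bracket
"`O^×(A) ≅ S¹ ⊗_ℤ ℚ` for `A` complex" fails at the complex isotropic tip-`1` object: its unit `−1`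
(`UnitStab.negUnit`) has order two, while `S¹ ⊗_ℤ ℚ` has no `2`-torsion.
[cite: MochizukiFrdII2008, Thm 3.6 (v) p.37] -/
theorem not_thm36v_isoCircleTensorRat_C_Q :
    ¬ Thm36v_isoCircleTensorRat (𝟭 D0 ⋙ D0.toArchBase) (C.toElem (𝟭 D0)) MonoidType.Q := by
  intro h
  obtain ⟨e⟩ := h rfl (unitObjOver (𝟭 D0) D0.complex) unitObjOver_complex
  have hne : e (Additive.ofMul (UnitStab.negUnit (𝟭 D0) _ unitObjOver_naive)) ≠ 0 := by
    intro h0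
    refine UnitStab.negUnit_ne_one (𝟭 D0) (unitObjOver (𝟭 D0) D0.complex) unitObjOver_naive ?_
    have : Additive.ofMul (UnitStab.negUnit (𝟭 D0) _ unitObjOver_naive) = 0 :=
      e.injective (by rw [h0, map_zero])
    exact Additive.ofMul.injective this
  refine hne (eq_zero_of_add_self_eq_zero _ ?_)
  rw [← map_add, ← ofMul_mul, UnitStab.negUnit_mul_self, ofMul_one, map_zero]

/-- **F-0790 as a schema is not a fact:** the fully quantified closure of
`ArchFrd.Thm36v_isoCircleTensorRat` (at universe level `0`) is FALSE; the printed bracket is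
`UnitStab.thm36v_isoCircleTensorRat_C` (vacuous at `Λ = ℤ`), `ArchFrd.thm36v_isoCircleTensorRat_A`, and
at `Λ = ℚ` the perfection clause inside `Thm36Sub.v_Q_holds`. [cite: MochizukiFrdII2008, Thm 3.6 (v) p.37] -/
theorem not_forall_thm36v_isoCircleTensorRat :
    ¬ ∀ {D : Type} [Category.{0} D] (G : D ⥤ ArchBase) {Φ : Dᵒᵖ ⥤ CommMonCat.{0}} {X : Type}
        [Category.{0} X] (F : X ⥤ ElemFrobenioid Φ) (Λ : MonoidType), Thm36v_isoCircleTensorRat G F Λ :=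
  fun h => not_thm36v_isoCircleTensorRat_C_Q (h _ _ _)

/-! ### F-0791: `Thm36v_orderTwo` -/

/-- **F-0791, universal closure false:** with the label moved to `Λ := ℚ` on `C = C^ℤ`, the real tip-`1`
object still has `|O^×(A)| = 2` (`UnitStab.card_unitsSubgroup_of_isReal`) although "`Λ = ℤ`" fails.
[cite: MochizukiFrdII2008, Thm 3.6 (v) p.37] -/
theorem not_thm36v_orderTwo_C_Q :
    ¬ Thm36v_orderTwo (𝟭 D0 ⋙ D0.toArchBase) (C.toElem (𝟭 D0)) MonoidType.Q := fun h =>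
  MonoidType.noConfusion ((h (unitObjOver (𝟭 D0) D0.real)).mp
    (UnitStab.card_unitsSubgroup_of_isReal (𝟭 D0) (unitObjOver (𝟭 D0) D0.real)
      unitObjOver_real_isReal)).1

/-- **F-0791 as a schema is not a fact:** the fully quantified closure of `ArchFrd.Thm36v_orderTwo` (at
universe level `0`) is FALSE; instance forms as for F-0794. [cite: MochizukiFrdII2008, Thm 3.6 (v) p.37] -/
theorem not_forall_thm36v_orderTwo :
    ¬ ∀ {D : Type} [Category.{0} D] (G : D ⥤ ArchBase) {Φ : Dᵒᵖ ⥤ CommMonCat.{0}} {X : Type}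
        [Category.{0} X] (F : X ⥤ ElemFrobenioid Φ) (Λ : MonoidType), Thm36v_orderTwo G F Λ :=
  fun h => not_thm36v_orderTwo_C_Q (h _ _ _)

/-! ### F-0792: `Thm36v_torsion` -/

/-- **F-0792, universal closure false:** with the label moved to `Λ := ℚ` on `C = C^ℤ`, the complex
isotropic tip-`1` object still has infinitely many torsion units (`UnitStab.torsion_infinite_of_isComplex`)
although "`Λ = ℤ`" fails. [cite: MochizukiFrdII2008, Thm 3.6 (v) p.37] -/
theorem not_thm36v_torsion_C_Q :
    ¬ Thm36v_torsion (𝟭 D0 ⋙ D0.toArchBase) (C.toElem (𝟭 D0)) MonoidType.Q := fun h =>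
  MonoidType.noConfusion ((h (unitObjOver (𝟭 D0) D0.complex)).mp
    (UnitStab.torsion_infinite_of_isComplex (𝟭 D0) (unitObjOver (𝟭 D0) D0.complex)
      unitObjOver_naive unitObjOver_isComplexObj)).1

/-- **F-0792 as a schema is not a fact:** the fully quantified closure of `ArchFrd.Thm36v_torsion` (at
universe level `0`) is FALSE; instance forms as for F-0794. [cite: MochizukiFrdII2008, Thm 3.6 (v) p.37] -/
theorem not_forall_thm36v_torsion :
    ¬ ∀ {D : Type} [Category.{0} D] (G : D ⥤ ArchBase) {Φ : Dᵒᵖ ⥤ CommMonCat.{0}} {X : Type}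
        [Category.{0} X] (F : X ⥤ ElemFrobenioid Φ) (Λ : MonoidType), Thm36v_torsion G F Λ :=
  fun h => not_thm36v_torsion_C_Q (h _ _ _)

/-! ### F-0789: `Thm36v_isoCircle` -/

/-- **F-0789, universal closure false:** with the comparison functor `G` moved to the CONSTANT functor
with value `Spec ℂ`, the REAL tip-`1` object of `C = C^ℤ` counts as "complex isotropic", but its
`O^×(A)` has two elements and is not `≅ S¹` (which is infinite, `UnitStab.circle_torsion_infinite`).
[cite: MochizukiFrdII2008, Thm 3.6 (v) p.37] -/
theorem not_thm36v_isoCircle_C_constBase :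
    ¬ Thm36v_isoCircle ((Functor.const D0).obj (D0.toArchBase.obj D0.complex)) (C.toElem (𝟭 D0))
        MonoidType.Z := by
  intro h
  obtain ⟨e⟩ := h rfl (unitObjOver (𝟭 D0) D0.real)
    ((D0.isComplex_toArchBase_iff D0.complex).mpr rfl)
    ((Ex33ii_isotropic_iff_holds (𝟭 D0) (unitObjOver (𝟭 D0) D0.real)).mpr
      (AngularRegion.isIsotropic_isotropicOfTip 1))
  haveI : Infinite Circle :=
    Set.infinite_univ_iff.mp (UnitStab.circle_torsion_infinite.mono (Set.subset_univ _))
  have h2 := UnitStab.card_unitsSubgroup_of_isReal (𝟭 D0) (unitObjOver (𝟭 D0) D0.real)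
    unitObjOver_real_isReal
  rw [Nat.card_congr e.toEquiv, Nat.card_eq_zero_of_infinite] at h2
  exact absurd h2 (by decide)

/-- **F-0789 as a schema is not a fact:** the fully quantified closure of `ArchFrd.Thm36v_isoCircle` (at
universe level `0`) is FALSE; the printed bracket "`O^×(A) ≅ S¹` for `Λ = ℤ`, `A` complex isotropic" is
`ArchFrd.thm36v_isoCircle_C` / `thm36v_isoCircle_A` at the comparison functor of Example 3.3.
[cite: MochizukiFrdII2008, Thm 3.6 (v) p.37] -/
theorem not_forall_thm36v_isoCircle :
    ¬ ∀ {D : Type} [Category.{0} D] (G : D ⥤ ArchBase) {Φ : Dᵒᵖ ⥤ CommMonCat.{0}} {X : Type}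
        [Category.{0} X] (F : X ⥤ ElemFrobenioid Φ) (Λ : MonoidType), Thm36v_isoCircle G F Λ :=
  fun h => not_thm36v_isoCircle_C_constBase (h _ _ _)

/-! ### F-1298: `Thm36vii_equiv` -/

/-- **F-1298, universal closure false:** with the boundary data moved to `∂A_A := ∅` (ambient space a
point), `Open⁰(∂A_A)` has NO object (connected sets are nonempty) while `F^imtr-pre_A` always contains the
identity of `A` (an isometric pre-step); so no equivalence `F^imtr-pre_A ⥲ Open⁰(∂A_A)` exists at the
complex tip-`1` object of `C`. [cite: MochizukiFrdII2008, Thm 3.6 (vii) p.37] -/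
theorem not_thm36vii_equiv_C_emptyBoundary :
    ¬ Thm36vii_equiv (𝟭 D0 ⋙ D0.toArchBase) (C.toElem (𝟭 D0)) MonoidType.Z (fun _ => Unit)
        (fun _ => (∅ : Set Unit)) (fun ⦃_ _⦄ _ x => x) := by
  intro h
  obtain ⟨e, -⟩ := h rfl (unitObjOver (𝟭 D0) D0.complex) unitObjOver_complex
  have hid : PreFrobenioid.IsIsometry (C.toElem (𝟭 D0)) (𝟙 (unitObjOver (𝟭 D0) D0.complex)) ∧
      PreFrobenioid.IsPreStep (C.toElem (𝟭 D0)) (𝟙 (unitObjOver (𝟭 D0) D0.complex)) := by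
    refine ⟨PreFrobenioid.div_id _ _, PreFrobenioid.degFr_id _ _, ?_⟩
    change IsIso (PreFrobenioid.Base (C.toElem (𝟭 D0)) (𝟙 (unitObjOver (𝟭 D0) D0.complex)))
    rw [PreFrobenioid.base_id]
    infer_instance
  obtain ⟨x, -⟩ := (e.functor.obj ⟨Over.mk (𝟙 (unitObjOver (𝟭 D0) D0.complex)), hid⟩).property.nonempty
  exact x.2

/-- **F-1298 as a schema is not a fact:** the fully quantified closure of `ArchFrd.Thm36vii_equiv` (over
all `G, F, Λ` and all topological data `V, bd, vMap`, at universe level `0`) is FALSE; the printed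
equivalence `F^imtr-pre_A ⥲ Open⁰(∂A_A)` is `ArchFrd.thm36vii_equiv_C` (inside `thm36vii_C`, F-0884 ✓) /
the angular twin inside `thm36vii_A` (F-0883 ✓). [cite: MochizukiFrdII2008, Thm 3.6 (vii) p.37] -/
theorem not_forall_thm36vii_equiv :
    ¬ ∀ {D : Type} [Category.{0} D] (G : D ⥤ ArchBase) {Φ : Dᵒᵖ ⥤ CommMonCat.{0}} {X : Type}
        [Category.{0} X] (F : X ⥤ ElemFrobenioid Φ) (Λ : MonoidType) (V : X → Type)
        [∀ A, TopologicalSpace (V A)] (bd : ∀ A : X, Set (V A))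
        (vMap : ∀ ⦃B A : X⦄, (B ⟶ A) → V B → V A), Thm36vii_equiv G F Λ V bd vMap :=
  fun h => not_thm36vii_equiv_C_emptyBoundary (h _ _ _ (fun _ => Unit) (fun _ => (∅ : Set Unit))
    (fun ⦃_ _⦄ _ x => x))

/-! ### F-1299: `Thm36vii_recover` -/

/-- **F-1299, universal closure false:** with the ambient space moved to the Cantor space `ℕ → Bool` and
`∂A_A := ` everything, the claimed local connectedness of `∂A_A` at the complex tip-`1` object of `C`
fails: an infinite profinite space is not locally connected ([FrdII] Rmk. A.2.1,
`TopRep.RmkA21_profinite_holds`). [cite: MochizukiFrdII2008, Thm 3.6 (vii) p.38] -/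
theorem not_thm36vii_recover_C_cantor :
    ¬ Thm36vii_recover (𝟭 D0 ⋙ D0.toArchBase) (C.toElem (𝟭 D0)) MonoidType.Z (fun _ => ℕ → Bool)
        (fun _ => Set.univ) := by
  intro h
  obtain ⟨-, hlc⟩ := h rfl (unitObjOver (𝟭 D0) D0.complex) unitObjOver_complex
  haveI := hlc
  have hlc' : LocallyConnectedSpace (ℕ → Bool) :=
    (Homeomorph.Set.univ (ℕ → Bool)).symm.locallyConnectedSpace
  exact (TopRep.RmkA21_profinite_holds (ℕ → Bool) inferInstance inferInstance inferInstance
    inferInstance).2 hlc'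

/-- **F-1299 as a schema is not a fact:** the fully quantified closure of `ArchFrd.Thm36vii_recover` (at
universe level `0`) is FALSE; the printed recovery of `∂A_A ≅ S¹` (sober, locally connected) is
`ArchFrd.thm36vii_recover_C` (inside `thm36vii_C`, F-0884 ✓) / the angular twin inside `thm36vii_A`.
[cite: MochizukiFrdII2008, Thm 3.6 (vii) p.38] -/
theorem not_forall_thm36vii_recover :
    ¬ ∀ {D : Type} [Category.{0} D] (G : D ⥤ ArchBase) {Φ : Dᵒᵖ ⥤ CommMonCat.{0}} {X : Type}
        [Category.{0} X] (F : X ⥤ ElemFrobenioid Φ) (Λ : MonoidType) (V : X → Type)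
        [∀ A, TopologicalSpace (V A)] (bd : ∀ A : X, Set (V A)), Thm36vii_recover G F Λ V bd :=
  fun h => not_thm36vii_recover_C_cantor (h _ _ _ (fun _ => ℕ → Bool) (fun _ => Set.univ))

/-! ### F-0795: `Thm36vii_torsor` -/

/-- **F-0795, universal closure false:** with the boundary data moved to the two-point set `Bool` on
which every arrow acts as the identity, `O^×(A)` (acting trivially) is not transitive: no unit moves
`true` to `false` at the complex isotropic tip-`1` object of `C`. [cite: MochizukiFrdII2008, Thm 3.6 (vii) p.38] -/
theorem not_thm36vii_torsor_C_bool :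
    ¬ Thm36vii_torsor (𝟭 D0 ⋙ D0.toArchBase) (C.toElem (𝟭 D0)) MonoidType.Z (fun _ => Bool)
        (fun _ => Set.univ) (fun ⦃_ _⦄ _ b => b) := by
  intro h
  obtain ⟨u, hu, -⟩ := h rfl (unitObjOver (𝟭 D0) D0.complex) unitObjOver_complex
    unitObjOver_isIsotropic true (Set.mem_univ _) false (Set.mem_univ _)
  exact Bool.noConfusion hu

/-- **F-0795 as a schema is not a fact:** the fully quantified closure of `ArchFrd.Thm36vii_torsor` (at
universe level `0`) is FALSE; the printed torsor structure of `∂A_A` over `O^×(A)` is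
`ArchFrd.thm36vii_torsor_C` (inside `thm36vii_C`, F-0884 ✓) / the angular twin inside `thm36vii_A`.
[cite: MochizukiFrdII2008, Thm 3.6 (vii) p.38] -/
theorem not_forall_thm36vii_torsor :
    ¬ ∀ {D : Type} [Category.{0} D] (G : D ⥤ ArchBase) {Φ : Dᵒᵖ ⥤ CommMonCat.{0}} {X : Type}
        [Category.{0} X] (F : X ⥤ ElemFrobenioid Φ) (Λ : MonoidType) (V : X → Type)
        (bd : ∀ A : X, Set (V A)) (vMap : ∀ ⦃B A : X⦄, (B ⟶ A) → V B → V A),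
        Thm36vii_torsor G F Λ V bd vMap :=
  fun h => not_thm36vii_torsor_C_bool (h _ _ _ (fun _ => Bool) (fun _ => Set.univ)
    (fun ⦃_ _⦄ _ b => b))

end ArchFrd

end Literature.AlgebraicGeometry.Frobenioids
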